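import Mathlib
import Summits.NavierStokesRegularity.NavierStokesRegularity.Theorems.HeteroclinicTriggerChainTriggerChainFrontStepNormalForm
import HarnessLib

/-!
# `HeteroclinicTriggerChain` — crux `TriggerChainFrontStep` (item stmt-NavierStokesRegularity-22785):
  the CARRIER ROW of the cascade nonlinearity for ARBITRARY families (signed squares only)

Companion to the registered stub `stub_normal_form` (tree file `…TriggerChainFrontStepNormalForm`) and
to the row formulas on connection-shaped families (`…TriggerChainFrontStepConnectionAlgebra`). Here the
family `X` is ARBITRARY (all modes, all shells — the states of the running chain with wake, junk modes
and upper triggers), and we evaluate the row of the carrier mode `i₀` at every shell `n`: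

* `htcCR_alpha_carrier_100_eq_zero`, `htcCR_alpha_carrier_010_eq_zero` — in normal form the carrier
  receives NO BACK-REACTION from the shell above, whatever the inputs: `α a b i₀ (1,0,0) =
  α a b i₀ (0,1,0) = 0` for all `a, b` (cancellation (4.3) at `(a, b, i₀; 1,0,0)`, whose four mixed
  terms vanish by the normal form, plus symmetry (4.2));
* `htcCR_quadTerm_carrier` — hence, for every family `X` and shell `n`,
  `quadTerm 1 α X i₀ n = −2^{5n/2} ∑ₐ d a 0 · X_{a,n}² + 2^{5(n−1)/2} ∑ₐ α a a i₀ (0,0,1) · X_{a,n−1}²`: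
  SIGNED SQUARES ONLY — the drain `−e·u²` by the shell's own trigger (`d i₁ 0 = e`), the feed
  `|d_j(0)|·X_j²` by the junk modes of the shell (`d ≤ 0` off the trigger), and the pump
  `g_a·X_{a,n−1}²` (`g_a = α a a i₀ (0,0,1) ≥ 0`) by every non-carrier mode of the shell below (the wake);
* `htcCR_quadTerm_carrier_zero`, `htcCR_quadTerm_carrier_one` — the front-block instances `n = 0`
  (carrier `x`) and `n = 1` (receiver `y`, gains `2^{5/2}` and `1`): the lattice versions of
  `x′ = −eu² + …`, `y′ = eu² − e′v² + …` with their exact, sign-definite remainders (the forcing `f₁`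
  of the forced transfer arc, `…TriggerChainFrontStepForcedArc`).

HONEST FRAMING: finite algebra of structure constants of Tao-type MODEL lattices (Tao 2016 §4); helper for
the crux (no stub credit); nothing here is a statement about the Navier–Stokes equations; no summit,
rung or crux is proved by this file.
-/

noncomputable section

set_option linter.dupNamespace false

namespace Summit.NavierStokesRegularity.NavierStokesRegularity.Theorems

open Literature.Analysis.FluidPDE Literature.Analysis.FluidPDE.TaoCascade

/-- **No back-reaction on the carrier, shift `(1,0,0)`.** In the normal form of a symmetric cancelling
table at a diagonal pure-mode saddle, `α a b i₀ (1,0,0) = 0` for ALL input modes `a, b`: the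
cancellation identity (4.3) at `(a, b, i₀; 1, 0, 0)` reads
`α a b i₀(100) + α a i₀ b(100) + α b a i₀(010) + α b i₀ a(001) + α i₀ a b(010) + α i₀ b a(001) = 0`,
its four mixed terms vanish by the normal form, and the remaining two are equal by (4.2). [this file] -/
theorem htcCR_alpha_carrier_100_eq_zero (α : Fin 4 → Fin 4 → Fin 4 → ℤ × ℤ × ℤ → ℝ) (i₀ : Fin 4)
    (d : Fin 4 → ℤ → ℝ)
    (hsym : IsSymmetricCoeff α) (hcanc : IsCancellingCoeff α)
    (hpure : ∀ X : Fin 4 → ℤ → ℝ → ℝ, (∀ i n t, i ≠ i₀ → X i n t = 0) →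
      ∀ i n t, quadTerm 1 α X i n t = 0)
    (hsad : ∀ (Y : Fin 4 → ℤ → ℝ → ℝ) (i : Fin 4) (n : ℤ) (t : ℝ),
      quadTerm 1 α (fun j m s => (fun j m (_ : ℝ) => if j = i₀ ∧ m = 0 then (1 : ℝ) else 0) j m s +
          Y j m s) i n t -
        quadTerm 1 α (fun j m (_ : ℝ) => if j = i₀ ∧ m = 0 then (1 : ℝ) else 0) i n t -
        quadTerm 1 α Y i n t = d i n * Y i n t)
    (a b : Fin 4) : α a b i₀ (1, 0, 0) = 0 := by
  obtain ⟨-, nf2, -⟩ := HeteroclinicTriggerChain.stub_normal_form α i₀ d hsym hcanc hpure hsad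
  have m100 : ((1 : ℤ), (0 : ℤ), (0 : ℤ)) ∈ shiftSet := by decide
  have hc := hcanc a b i₀ 1 0 0 m100
  have h1 : α a i₀ b (1, 0, 0) = 0 := (nf2 a b).2.2.1
  have h2 : α b i₀ a (0, 0, 1) = 0 := (nf2 b a).2.1
  have h3 : α i₀ a b (0, 1, 0) = 0 := (nf2 a b).2.2.2
  have h4 : α i₀ b a (0, 0, 1) = 0 := (nf2 b a).1
  have hs : α a b i₀ (1, 0, 0) = α b a i₀ (0, 1, 0) := hsym a b i₀ 1 0 0 m100
  linarith

/-- **No back-reaction on the carrier, shift `(0,1,0)`** (the (4.2)-mirror of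
`htcCR_alpha_carrier_100_eq_zero`): `α a b i₀ (0,1,0) = 0` for all `a, b`. [this file] -/
theorem htcCR_alpha_carrier_010_eq_zero (α : Fin 4 → Fin 4 → Fin 4 → ℤ × ℤ × ℤ → ℝ) (i₀ : Fin 4)
    (d : Fin 4 → ℤ → ℝ)
    (hsym : IsSymmetricCoeff α) (hcanc : IsCancellingCoeff α)
    (hpure : ∀ X : Fin 4 → ℤ → ℝ → ℝ, (∀ i n t, i ≠ i₀ → X i n t = 0) →
      ∀ i n t, quadTerm 1 α X i n t = 0)
    (hsad : ∀ (Y : Fin 4 → ℤ → ℝ → ℝ) (i : Fin 4) (n : ℤ) (t : ℝ),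
      quadTerm 1 α (fun j m s => (fun j m (_ : ℝ) => if j = i₀ ∧ m = 0 then (1 : ℝ) else 0) j m s +
          Y j m s) i n t -
        quadTerm 1 α (fun j m (_ : ℝ) => if j = i₀ ∧ m = 0 then (1 : ℝ) else 0) i n t -
        quadTerm 1 α Y i n t = d i n * Y i n t)
    (a b : Fin 4) : α a b i₀ (0, 1, 0) = 0 := by
  have m010 : ((0 : ℤ), (1 : ℤ), (0 : ℤ)) ∈ shiftSet := by decide
  rw [hsym a b i₀ 0 1 0 m010]
  exact htcCR_alpha_carrier_100_eq_zero α i₀ d hsym hcanc hpure hsad b a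

/-- **CARRIER ROW FOR ARBITRARY FAMILIES.** In the normal form (symmetric, cancelling, pure-`i₀`
families force-free, diagonal polarisation with rate table `d`), for EVERY lattice family `X` and every
shell `n`, the carrier mode is driven by signed squares only:
`quadTerm 1 α X i₀ n t = −2^{5n/2} ∑ₐ d a 0 · X_{a,n}(t)² + 2^{5(n−1)/2} ∑ₐ α a a i₀ (0,0,1) · X_{a,n−1}(t)²`
(no back-reaction from shell `n+1`, no cross terms). [this file] -/
theorem htcCR_quadTerm_carrier (α : Fin 4 → Fin 4 → Fin 4 → ℤ × ℤ × ℤ → ℝ) (i₀ : Fin 4)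
    (d : Fin 4 → ℤ → ℝ)
    (hsym : IsSymmetricCoeff α) (hcanc : IsCancellingCoeff α)
    (hpure : ∀ X : Fin 4 → ℤ → ℝ → ℝ, (∀ i n t, i ≠ i₀ → X i n t = 0) →
      ∀ i n t, quadTerm 1 α X i n t = 0)
    (hsad : ∀ (Y : Fin 4 → ℤ → ℝ → ℝ) (i : Fin 4) (n : ℤ) (t : ℝ),
      quadTerm 1 α (fun j m s => (fun j m (_ : ℝ) => if j = i₀ ∧ m = 0 then (1 : ℝ) else 0) j m s +
          Y j m s) i n t -
        quadTerm 1 α (fun j m (_ : ℝ) => if j = i₀ ∧ m = 0 then (1 : ℝ) else 0) i n t -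
        quadTerm 1 α Y i n t = d i n * Y i n t)
    (X : Fin 4 → ℤ → ℝ → ℝ) (n : ℤ) (t : ℝ) :
    quadTerm 1 α X i₀ n t =
      -((1 + 1 : ℝ) ^ ((5 : ℝ) * n / 2) * ∑ a, d a 0 * X a n t ^ 2) +
        (1 + 1 : ℝ) ^ ((5 : ℝ) * ((n : ℝ) - 1) / 2) * ∑ a, α a a i₀ (0, 0, 1) * X a (n - 1) t ^ 2 := by
  obtain ⟨-, -, -, nf4, -, -, -, nf8, nf9⟩ :=
    HeteroclinicTriggerChain.stub_normal_form α i₀ d hsym hcanc hpure hsad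
  have h100 := htcCR_alpha_carrier_100_eq_zero α i₀ d hsym hcanc hpure hsad
  have h010 := htcCR_alpha_carrier_010_eq_zero α i₀ d hsym hcanc hpure hsad
  rw [htcNF_quadTerm_expand]
  -- same-shell block: diagonal, value -d a 0 · X_{a,n}²; back-reaction blocks vanish
  have hmain : ∀ a b : Fin 4,
      α a b i₀ (0, 0, 0) * (X a n t * X b n t) + α a b i₀ (1, 0, 0) * (X a (n + 1) t * X b n t) +
        α a b i₀ (0, 1, 0) * (X a n t * X b (n + 1) t) =
      if b = a then -(d a 0) * X a n t ^ 2 else 0 := by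
    intro a b
    rw [h100 a b, h010 a b, zero_mul, zero_mul, add_zero, add_zero]
    by_cases hab : b = a
    · rw [hab, if_pos rfl, (nf9 a).1, nf4 a]
      ring
    · rw [if_neg hab, (nf8 a b (Ne.symm hab)).2, zero_mul]
  -- pump block: diagonal
  have hpump : ∀ a b : Fin 4, α a b i₀ (0, 0, 1) * (X a (n - 1) t * X b (n - 1) t) =
      if b = a then α a a i₀ (0, 0, 1) * X a (n - 1) t ^ 2 else 0 := by
    intro a b
    by_cases hab : b = a
    · rw [hab, if_pos rfl]; ring
    · rw [if_neg hab, (nf8 a b (Ne.symm hab)).1, zero_mul]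
  rw [Finset.sum_congr rfl fun a _ => Finset.sum_congr rfl fun b _ => hmain a b,
    Finset.sum_congr rfl fun a _ => Finset.sum_congr rfl fun b _ => hpump a b]
  simp only [Finset.sum_ite_eq', Finset.mem_univ, if_true]
  rw [show ∑ a : Fin 4, -d a 0 * X a n t ^ 2 = -∑ a : Fin 4, d a 0 * X a n t ^ 2 by
    rw [← Finset.sum_neg_distrib]; exact Finset.sum_congr rfl fun a _ => by ring]
  ring

/-- **Carrier row at the front shell `n = 0`** (the lattice `x′`): `quadTerm 1 α X i₀ 0 t =
−∑ₐ d a 0 · X_{a,0}(t)² + 2^{−5/2} ∑ₐ α a a i₀ (0,0,1) · X_{a,−1}(t)²` — own-trigger drain and junk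
feed at shell `0`, plus the WAKE PUMP from shell `−1`. [this file] -/
theorem htcCR_quadTerm_carrier_zero (α : Fin 4 → Fin 4 → Fin 4 → ℤ × ℤ × ℤ → ℝ) (i₀ : Fin 4)
    (d : Fin 4 → ℤ → ℝ)
    (hsym : IsSymmetricCoeff α) (hcanc : IsCancellingCoeff α)
    (hpure : ∀ X : Fin 4 → ℤ → ℝ → ℝ, (∀ i n t, i ≠ i₀ → X i n t = 0) →
      ∀ i n t, quadTerm 1 α X i n t = 0)
    (hsad : ∀ (Y : Fin 4 → ℤ → ℝ → ℝ) (i : Fin 4) (n : ℤ) (t : ℝ),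
      quadTerm 1 α (fun j m s => (fun j m (_ : ℝ) => if j = i₀ ∧ m = 0 then (1 : ℝ) else 0) j m s +
          Y j m s) i n t -
        quadTerm 1 α (fun j m (_ : ℝ) => if j = i₀ ∧ m = 0 then (1 : ℝ) else 0) i n t -
        quadTerm 1 α Y i n t = d i n * Y i n t)
    (X : Fin 4 → ℤ → ℝ → ℝ) (t : ℝ) :
    quadTerm 1 α X i₀ 0 t =
      -(∑ a, d a 0 * X a 0 t ^ 2) +
        (2 : ℝ) ^ (-((5 : ℝ) / 2)) * ∑ a, α a a i₀ (0, 0, 1) * X a (-1) t ^ 2 := by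
  rw [htcCR_quadTerm_carrier α i₀ d hsym hcanc hpure hsad X 0 t]
  have h1 : (1 + 1 : ℝ) ^ ((5 : ℝ) * ((0 : ℤ) : ℝ) / 2) = 1 := by simp
  have h2 : (1 + 1 : ℝ) ^ ((5 : ℝ) * (((0 : ℤ) : ℝ) - 1) / 2) = (2 : ℝ) ^ (-((5 : ℝ) / 2)) := by
    norm_num
  rw [h1, h2, one_mul, zero_sub]

/-- **Carrier row at the receiver shell `n = 1`** (the lattice `y′`): `quadTerm 1 α X i₀ 1 t =
−2^{5/2} ∑ₐ d a 0 · X_{a,1}(t)² + ∑ₐ α a a i₀ (0,0,1) · X_{a,0}(t)²` — the pump by every non-carrier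
mode of shell `0` (the trigger: `g·u²`), minus the drain by the upper trigger at the faster clock
`2^{5/2}` (`−e′v²`, `e′ = 2^{5/2}e`), plus the junk feed at shell `1`. [this file] -/
theorem htcCR_quadTerm_carrier_one (α : Fin 4 → Fin 4 → Fin 4 → ℤ × ℤ × ℤ → ℝ) (i₀ : Fin 4)
    (d : Fin 4 → ℤ → ℝ)
    (hsym : IsSymmetricCoeff α) (hcanc : IsCancellingCoeff α)
    (hpure : ∀ X : Fin 4 → ℤ → ℝ → ℝ, (∀ i n t, i ≠ i₀ → X i n t = 0) →
      ∀ i n t, quadTerm 1 α X i n t = 0)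
    (hsad : ∀ (Y : Fin 4 → ℤ → ℝ → ℝ) (i : Fin 4) (n : ℤ) (t : ℝ),
      quadTerm 1 α (fun j m s => (fun j m (_ : ℝ) => if j = i₀ ∧ m = 0 then (1 : ℝ) else 0) j m s +
          Y j m s) i n t -
        quadTerm 1 α (fun j m (_ : ℝ) => if j = i₀ ∧ m = 0 then (1 : ℝ) else 0) i n t -
        quadTerm 1 α Y i n t = d i n * Y i n t)
    (X : Fin 4 → ℤ → ℝ → ℝ) (t : ℝ) :
    quadTerm 1 α X i₀ 1 t =
      -((2 : ℝ) ^ ((5 : ℝ) / 2) * ∑ a, d a 0 * X a 1 t ^ 2) +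
        ∑ a, α a a i₀ (0, 0, 1) * X a 0 t ^ 2 := by
  rw [htcCR_quadTerm_carrier α i₀ d hsym hcanc hpure hsad X 1 t]
  have h1 : (1 + 1 : ℝ) ^ ((5 : ℝ) * ((1 : ℤ) : ℝ) / 2) = (2 : ℝ) ^ ((5 : ℝ) / 2) := by norm_num
  have h2 : (1 + 1 : ℝ) ^ ((5 : ℝ) * (((1 : ℤ) : ℝ) - 1) / 2) = 1 := by norm_num
  rw [h1, h2, one_mul, sub_self]

end Summit.NavierStokesRegularity.NavierStokesRegularity.Theorems

end
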